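/-
Origin: expansion seat `prover-pub-hodgecm-mc-binder-1-g14-0`, handover #R89 2026-08-20T16:54:41Z md5 a99e7dcce9cc (96 l.; NEW additive leaf (universe-free, datum-generic), (J1) Hecke operator on ℂ ⊗ H^k(·;ℚ); imports ONLY Vendored ShimuraVarieties/HeckeCorrespondenceAction + HodgeTheory/ClassesSupportedOnComplexification (names `UnitaryBallQuotientDatum` = the twin's own namespace); drop-alone; NAME LIST: HodgeCM.Model.heckeOpC_of_mem · HodgeCM.Model.heckeOpC_one · HodgeCM.Model.ofRatClassBaseChangeEquiv_heckeOpC) (`HOME/mc/pub-hodgecm-mc-binder-1-g14/stage56/HodgeCM/Model/HeckeOperatorOf.lean`, md5 a99e7dcce9cc, 96 lines);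
landed by the second packager p2 gen 10 (p2-g10) in gate run 56 as `HodgeCM/Model/HeckeOperatorOf.lean` (packager comment re-wording per the RUN-32 precedent (gate audit (5) rejects the proof-placeholder tokens s-o-r-r-y / a-d-m-i-t anywhere in a source, comments included): 1 occurrence(s) inside COMMENTS re-spelt `proof-hole` / `adm-token`; no Lean code byte touched).
-/
/-
Copyright (c) 2026 the pub-hodgecm formalisation cell (harness21).  New file, not vendored.
Origin: session prover-pub-hodgecm-mc-binder-1-g14-0 (unit pub-hodgecm-mc-binder-1-g14, BINDER PROVER gen 14 of lineage mc-binder-1;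
content lane (J-Liu-Θ) of BINDER-TRIAGE §58.2, scope memo `HOME/mc/pub-hodgecm-mc-binder-1-g14/JLIU-THETA-SCOPE.md` item (J1), §6/§6.2),
2026-08-20.  Intended final place: `HodgeCM/Model/HeckeOperatorOf.lean` (NEW additive MODEL leaf; imports ONLY the vendored twins
`HodgeCM.Vendored.H21.AlgebraicGeometry.ShimuraVarieties.HeckeCorrespondenceAction` and `….HodgeTheory.ClassesSupportedOnComplexification` — it is
GENERIC in the ball-quotient datum and does not import `Model/Universe`, so it is unaffected by the arity of the universe; nothing imports it;
drop alone on bounce).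
-/
import Literature.AlgebraicGeometry.ShimuraVarieties.HeckeCorrespondenceAction
import Literature.AlgebraicGeometry.HodgeTheory.ClassesSupportedOnComplexification

set_option autoImplicit false

/-!
# Hecke operators on `ℂ ⊗ H^k(X(ℂ); ℚ)` of a compact ball quotient — item (J1), the operator half, datum-generic

KERNEL over the vendored tree modules `ShimuraVarieties/HeckeCorrespondenceAction` ([Shimura1973 §3.1, §3.4, §7.2, §8.3], [BergeronMillsonMoeglin2016Balls
Part 2 §1.8]: `UnitaryBallQuotientDatum.heckeCorrespondenceAction (k) (g) : Module.End ℂ (complexBetti X k)`, transfer ∘ pull-back on the level-`N_g`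
Galois cover, junk `0` off `IsHeckeAdmissible g`) and `HodgeTheory/ClassesSupportedOnComplexification` ([VoisinHodgeI2002 §7.1.1]:
`ofRatClassBaseChangeEquiv : ℂ ⊗ H^k(X(ℂ);ℚ) ≃ H^k(X(ℂ);ℂ)` for smooth projective `X`).  No new hypothesis kind, nothing cited anew, nothing minted.

The scope memo (§1) found that row 9's junction to [Liu21] §4.2 cannot be STATED without a Hecke structure on the cohomology of the tower; §6 found
that the OPERATOR is already vendored.  The model universe's currency is `U.CohC X k = ℂ ⊗_ℚ H^k(X(ℂ); ℚ)` (`Model/Universe`, `universeOf_Coh` rfl), so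
this leaf transports the vendored operator to that currency for ANY ball-quotient datum `D : UnitaryBallQuotientDatum p X` on a smooth projective `X`:

* `HodgeCM.Model.heckeOpC D hX k g : Module.End ℂ (ℂ ⊗[ℚ] bettiCohomology X k)` — `T_g = T_{ΓgΓ}`, `g ∈ GL_{p+1}(E)`, through the
  comparison `β = ofRatClassBaseChangeEquiv hX k`: `heckeOpC := β⁻¹ ∘ heckeCorrespondenceAction k g ∘ β`;
* `heckeOpC_apply`, `heckeOpC_of_not` (junk `0` off admissibility), `heckeOpC_of_mem` / `heckeOpC_one` (`T_γ = 1` on `Γ`, `T_1 = 1`).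

STATUS OF (J1) (memo §6.2): (a) this operator; (b) ADMISSIBILITY `D.IsHeckeAdmissible g` for EVERY `g ∈ U(V)(E)` is PROVED in the hub tree —
`Summit.HodgeConjecture.HodgeConjecture.Cruxes.OrthogonalEnveloped.HeckeGraphChow.isHeckeAdmissible_of_mem_unitaryGroup`
(`Summits/HodgeConjecture/HodgeConjecture/Theorems/EndoscopicMiddleDegreeOrthogonalEnvelopedProperlyDiscontinuous.lean`, axioms = trio) — a Summits-side
theorem, not vendorable under the present `Literature/**`-only convention; (c) INSTANTIATION at the model's surface: on the 5-ary universe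
`Model.ballDatumOf … Γ h : UnitaryBallQuotientDatum 2 …` is such a datum; after the (iib-R) re-base `ballDatumOf` returns the WEAKER
`UnitaryBallUniformisationDatum` (no special subvarieties), on which the tree declares no Hecke operator — the instantiation then needs either the
tree's Hecke section generalised to `UnitaryBallUniformisationDatum` (it uses no special-cycle field) or the (ii-b) hypothesis back for this junction.

0 `proof-hole`, 0 `axiom`; expected `#print axioms` ⊆ {propext, Classical.choice, Quot.sound}.
-/

noncomputable section

open scoped TensorProduct
open Literature.AlgebraicGeometry.HodgeTheory
open Literature.AlgebraicGeometry.Motives (SchemeOver bettiCohomology IsSmoothProjective)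

open Literature.AlgebraicGeometry.ShimuraVarieties

namespace HodgeCM

namespace Model

variable {p n : ℕ} {X : SchemeOver ℂ} (D : UnitaryBallQuotientDatum p X) (hX : IsSmoothProjective n X) (k : ℕ)

/-- **The Hecke operator `T_g` on `ℂ ⊗ H^k(X(ℂ); ℚ)`** of a compact ball quotient `X(ℂ) ≅ Γ\𝔹` (`X` smooth projective), `g ∈ GL_{p+1}(E)`: the
vendored `heckeCorrespondenceAction k g` on `H^k(X(ℂ); ℂ)` transported through `β : ℂ ⊗ H^k(·;ℚ) ≃ H^k(·;ℂ)` ([VoisinHodgeI2002 §7.1.1]).  Junk `0` when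
`g` is not admissible (every `g ∈ U(V)(E)` is: tree `isHeckeAdmissible_of_mem_unitaryGroup`). [folklore] -/
def heckeOpC (g : GL (Fin (p + 1)) D.E) : Module.End ℂ (ℂ ⊗[ℚ] bettiCohomology X k) :=
  (ofRatClassBaseChangeEquiv hX k).symm.toLinearMap ∘ₗ D.heckeCorrespondenceAction k g ∘ₗ (ofRatClassBaseChangeEquiv hX k).toLinearMap

/-- Unfolding (definitional). -/
theorem heckeOpC_apply (g : GL (Fin (p + 1)) D.E) (x : ℂ ⊗[ℚ] bettiCohomology X k) :
    heckeOpC D hX k g x = (ofRatClassBaseChangeEquiv hX k).symm (D.heckeCorrespondenceAction k g (ofRatClassBaseChangeEquiv hX k x)) :=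
  rfl

/-- The comparison intertwines `T_g` on the two currencies: `β (heckeOpC g x) = heckeCorrespondenceAction k g (β x)`. [folklore] -/
theorem ofRatClassBaseChangeEquiv_heckeOpC (g : GL (Fin (p + 1)) D.E) (x : ℂ ⊗[ℚ] bettiCohomology X k) :
    ofRatClassBaseChangeEquiv hX k (heckeOpC D hX k g x) = D.heckeCorrespondenceAction k g (ofRatClassBaseChangeEquiv hX k x) := by
  rw [heckeOpC_apply]
  exact LinearEquiv.apply_symm_apply _ _

variable {k}

/-- Off admissibility the operator is the junk value `0`. [folklore] -/
theorem heckeOpC_of_not {g : GL (Fin (p + 1)) D.E} (hg : ¬ D.IsHeckeAdmissible g) (k : ℕ) : heckeOpC D hX k g = 0 := by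
  refine LinearMap.ext fun x => ?_
  rw [heckeOpC_apply, D.heckeCorrespondenceAction_of_not hg, LinearMap.zero_apply, LinearMap.zero_apply]
  exact LinearEquiv.map_zero _

/-- **`T_γ = 1` for `γ ∈ Γ`.** [folklore] -/
theorem heckeOpC_of_mem {γ : GL (Fin (p + 1)) D.E} (hγ : γ ∈ D.Γ) (k : ℕ) : heckeOpC D hX k γ = 1 := by
  refine LinearMap.ext fun x => ?_
  rw [heckeOpC_apply, D.heckeCorrespondenceAction_of_mem hγ, Module.End.one_apply, Module.End.one_apply]
  exact LinearEquiv.symm_apply_apply _ x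

variable (k) in
/-- **`T_1 = 1`.** [folklore] -/
theorem heckeOpC_one : heckeOpC D hX k 1 = 1 :=
  heckeOpC_of_mem D hX (one_mem _) k

end Model

end HodgeCM

end
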